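import Summits.KontsevichZagierPeriods.KontsevichZagierPeriods.Theses.FermatIsogeny
import Literature.NumberTheory.Transcendental.KZBetaChains
import Literature.NumberTheory.Transcendental.KZBetaUnitExponent
import Literature.NumberTheory.Transcendental.KZRelationsLE
import Literature.NumberTheory.Transcendental.KZLogCalculusProofs
import Literature.Analysis.SpecialFunctions.SelbergIntegralBasic
import Literature.NumberTheory.Transcendental.KZRulesAssociator
import Literature.NumberTheory.Transcendental.LindemannWeierstrassProofs

/-!
# `BetaLinearSector` on the HALF-INTEGER sector, UNCONDITIONALLY (the Wallis sector)

Crux `BetaLinearSector` (stmt-KontsevichZagierPeriods-3897, route FermatIsogeny): for positive rationals `a b a' b'` and a real algebraic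
`c`, two one-dimensional Kontsevich–Zagier representations pinned on `(0,1)` as `[t^{a-1}(1-t)^{b-1}]` and `[c·t^{a'-1}(1-t)^{b'-1}]`
with the same value are KZ-equivalent.  The general crux is closed modulo the named fact `HuberWustholzCurvePeriods`
(`Theorems/FermatIsogenyBetaLinearSectorGreen.lean`); THIS file proves it UNCONDITIONALLY on the sector `a, b, a', b' ∈ ½ℕ_{>0}`
(Beta values in `ℚ_{>0} ∪ ℚ_{>0}·π`), where the only transcendence input is Lindemann's theorem `π ∉ ℚ̄`, PROVED in the tree
(`transcendental_pi_holds`) — the registered anchor `betaLinearSector_halfIntegers`.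

Part I — LEVEL REDUCTION inside the calculus (adapted from the registrar's birth skeleton `Cruxes/BetaLinearSector/Lines/birth.lean`,
planner-skel-stmt-KontsevichZagierPeriods-3897, whose composition is sorry-free): a representation PINNED as `[(0,1), c·t^{a-1}(1-t)^{b-1}]`
exists for every real algebraic `c` and positive rationals `a, b` (`exists_pinned`), its value is `c·Γ(a)Γ(b)/Γ(a+b)` (`value_of_pinned`),
the swap `t ↦ 1 − t` (`pinned_swap`, one rule-2 move, `KZ.betaReflection_equivalent`) and the translation `c·β(a,b+1) ∼ (cb/(a+b))·β(a,b)`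
(`pinned_translate`, integration by parts = `KZ.betaTranslation_equivalent`) are chains of moves transported through algebraic scalars; so
the two-sided statement `P⟦a, b, a', b'⟧` ("any two representations pinned as `[c·β(a,b)]`, `[c'·β(a',b')]` with equal values are
equivalent") descends from `(a, b+1)` to `(a, b)`, is symmetric under the swap, and by strong induction on `⌊a⌋ + ⌊b⌋` reduces to exponents
in `(0,1]`, keeping HALF-INTEGRALITY (`P_of_base_left_half`).

Part II — LEVEL `2`: exponents in `{1/2, 1}` fall into the `π`-CLASS `(1/2, 1/2)` (`B(1/2,1/2) = Γ(1/2)² = π`) and the RATIONAL CLASS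
`(1/2, 1)`, `(1, 1/2)`, `(1, 1)` (values `2, 2, 1`), every member of which is a chain of moves away from a point representation `[pt, c·q]`
(`KZ.betaFirst_equivalent_unit_constMul`: one Newton–Leibniz move with the algebraic primitive `t^a/a`, after a swap for `(1, 1/2)`).  Two
`π`-cells with equal values have equal constants (rule 1b); two rational cells with equal values meet at the same point representation; a
`π`-cell never has the value of a rational cell with non-zero algebraic constants, by LINDEMANN; degenerate constants `c = 0` give two zero
representations.  Hence `betaLinearSector_halfIntegers`: **Conjecture 1 of Kontsevich–Zagier for every pair of Beta integrals with
half-integer parameters**, unconditionally.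

References: M. Kontsevich, D. Zagier, *Periods* (2001), §1.2; F. Lindemann, *Über die Zahl π*, Math. Ann. 20 (1882); G. E. Andrews,
R. Askey, R. Roy, *Special Functions* (1999), §1.1.
-/


noncomputable section

namespace Summit.KontsevichZagierPeriods.FermatIsogeny.BetaLinearSector.HalfIntegers

open MeasureTheory Set
open Literature.NumberTheory.Transcendental
open Literature.NumberTheory.Transcendental.KZ

set_option quotPrecheck false in
/-- `r` is PINNED as `[(0,1), c · t^{a-1}(1-t)^{b-1}]` (the two hypotheses on each representation in the crux, with a constant). -/
local notation "Pinned⟦" c ", " a ", " b ", " r "⟧" =>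
  (IntegralRep.domain r = {x : Fin 1 → ℝ | x 0 ∈ Set.Ioo (0:ℝ) 1} ∧
    Set.EqOn (IntegralRep.integrand r) (fun x : Fin 1 → ℝ => (c : ℝ) * (x 0) ^ (((a : ℚ) : ℝ) - 1) * (1 - x 0) ^ (((b : ℚ) : ℝ) - 1))
      (IntegralRep.domain r))

set_option quotPrecheck false in
/-- The two-sided, constant-carrying form of the crux for fixed exponents: any two representations pinned as `[c·β(a,b)]`,
`[c'·β(a',b')]` (`c, c'` real algebraic) with equal values are KZ-equivalent. -/
local notation "P⟦" a ", " b ", " a' ", " b' "⟧" =>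
  (∀ (c c' : ℝ) (r r' : IntegralRep 1), IsAlgebraic ℚ c → IsAlgebraic ℚ c' →
    Pinned⟦c, a, b, r⟧ → Pinned⟦c', a', b', r'⟧ → IntegralRep.value r = IntegralRep.value r' → Equivalent r r')

/-- Existence of pinned Beta representations for every real algebraic constant and positive rational exponents (semialgebraic
Euler–Mellin integrand, absolute convergence of the Beta integral). [cite: AndrewsAskeyRoy1999, Thm 1.1.4] -/
theorem exists_pinned (c : ℝ) (hc : IsAlgebraic ℚ c) {a b : ℚ} (ha : 0 < a) (hb : 0 < b) :
    ∃ r : IntegralRep 1, Pinned⟦c, a, b, r⟧ := by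
  have haR : (0:ℝ) < a := by exact_mod_cast ha
  have hbR : (0:ℝ) < b := by exact_mod_cast hb
  set g : ℝ → ℝ := fun t => t ^ ((a:ℝ) - 1) * (1 - t) ^ ((b:ℝ) - 1) with hg
  have hint : IntegrableOn (fun x : Fin 1 → ℝ => g (x 0)) {x | x 0 ∈ Set.Ioo (0:ℝ) 1} :=
    integrableOn_setOf_apply_mem_iff.2
      (Literature.Analysis.SpecialFunctions.Selberg.integrableOn_Ioo_rpow_mul_one_sub_rpow_and_integral_eq
        haR hbR).1
  have hsa : IsSemialgebraicFunOn ℚ {x : Fin 1 → ℝ | x 0 ∈ Set.Ioo (0:ℝ) 1}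
      (fun x : Fin 1 → ℝ => g (x 0)) :=
    (isSemialgebraicFunOn_const_mul_rpow_mul_rpow 1 (a - 1) (b - 1)).congr fun x _ => by
      simp only [hg, Rat.cast_one, one_mul, Rat.cast_sub]
  let r₀ : IntegralRep 1 := ⟨_, _, BallPeeling.isSemialgebraic_posIoo, hsa, hint⟩
  refine ⟨r₀.constMul c hc, rfl, fun x _ => ?_⟩
  simp only [IntegralRep.integrand_constMul, r₀, hg, mul_assoc]

/-- The value of a pinned representation is `c · B(a,b) = c · Γ(a)Γ(b)/Γ(a+b)`. [cite: AndrewsAskeyRoy1999, Thm 1.1.4] -/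
theorem value_of_pinned {c : ℝ} {a b : ℚ} {r : IntegralRep 1} (h : Pinned⟦c, a, b, r⟧)
    (ha : 0 < a) (hb : 0 < b) :
    r.value = c * (Real.Gamma (a:ℝ) * Real.Gamma (b:ℝ) / Real.Gamma ((a:ℝ) + (b:ℝ))) := by
  obtain ⟨hd, hi⟩ := h
  have haR : (0:ℝ) < a := by exact_mod_cast ha
  have hbR : (0:ℝ) < b := by exact_mod_cast hb
  rw [IntegralRep.value, setIntegral_congr_fun (IntegralRep.measurableSet_domain_holds r) hi, hd]
  have h1 := (volume_preserving_funUnique (Fin 1) ℝ).setIntegral_preimage_emb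
    (MeasurableEquiv.funUnique (Fin 1) ℝ).measurableEmbedding
    (fun t : ℝ => c * t ^ ((a:ℝ) - 1) * (1 - t) ^ ((b:ℝ) - 1)) (Ioo (0:ℝ) 1)
  have h2 : ∫ t in Ioo (0:ℝ) 1, c * t ^ ((a:ℝ) - 1) * (1 - t) ^ ((b:ℝ) - 1) =
      c * (Real.Gamma (a:ℝ) * Real.Gamma (b:ℝ) / Real.Gamma ((a:ℝ) + (b:ℝ))) := by
    rw [← (Literature.Analysis.SpecialFunctions.Selberg.integrableOn_Ioo_rpow_mul_one_sub_rpow_and_integral_eq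
      haR hbR).2, ← integral_const_mul]
    congr 1
    funext t
    ring
  rw [← h2, ← h1]
  rfl

/-- A pinned representation is KZ-equivalent to the scaling by `k` of a representation pinned with the same exponents and
constant `c₀`, as soon as `c = k c₀` (congruence of integrands on the common domain, rule 1b). [cite: KontsevichZagier2001, §1.2 rule (1)] -/
theorem equivalent_constMul_of_pinned {c c₀ k : ℝ} (hk : IsAlgebraic ℚ k) {a b : ℚ}
    {r T : IntegralRep 1} (hr : Pinned⟦c, a, b, r⟧) (hT : Pinned⟦c₀, a, b, T⟧) (hck : c = k * c₀) :
    Equivalent r (T.constMul k hk) :=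
  of_sub_of_mem_relations_of_eqOn (by rw [IntegralRep.domain_constMul, hT.1, hr.1]) fun x hx => by
    have hxT : x ∈ T.domain := by rw [hT.1, ← hr.1]; exact hx
    rw [hr.2 hx, IntegralRep.integrand_constMul]
    dsimp only
    rw [hT.2 hxT, hck]
    ring

/-- REFLECTION with constants: `[c·t^{a-1}(1-t)^{b-1}] ∼ [c·t^{b-1}(1-t)^{a-1}]` (one change of variables `t ↦ 1 − t`,
`KZ.betaReflection_equivalent`, transported through the scalar `c`). [cite: KontsevichZagier2001, §1.2 rule (2)] -/
theorem pinned_swap {c : ℝ} (hc : IsAlgebraic ℚ c) {a b : ℚ} (ha : 0 < a) (hb : 0 < b)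
    {r ρ : IntegralRep 1} (hr : Pinned⟦c, a, b, r⟧) (hρ : Pinned⟦c, b, a, ρ⟧) : Equivalent r ρ := by
  obtain ⟨T, hT⟩ := exists_pinned 1 isAlgebraic_one ha hb
  obtain ⟨T', hT'⟩ := exists_pinned 1 isAlgebraic_one hb ha
  have h : Equivalent T T' :=
    betaReflection_equivalent ((a:ℝ) - 1) ((b:ℝ) - 1) T T' hT.1
      (fun x hx => by simp only [hT.2 hx, one_mul]) hT'.1 (fun x hx => by simp only [hT'.2 hx, one_mul])
  have e₁ : Equivalent r (T.constMul c hc) := equivalent_constMul_of_pinned hc hr hT (mul_one c).symm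
  have e₂ : Equivalent ρ (T'.constMul c hc) := equivalent_constMul_of_pinned hc hρ hT' (mul_one c).symm
  exact e₁.trans ((h.constMul c hc).trans e₂.symm)

/-- TRANSLATION with constants (integration by parts inside the rules, `KZ.betaTranslation_equivalent` transported through
scalars): `[c·t^{a-1}(1-t)^{b}] ∼ [(c b/(a+b))·t^{a-1}(1-t)^{b-1}]`, the value identity `c·B(a,b+1) = (c b/(a+b))·B(a,b)`.
[cite: AndrewsAskeyRoy1999, §1.1] -/
theorem pinned_translate {c : ℝ} (hc : IsAlgebraic ℚ c) {a b : ℚ} (ha : 0 < a) (hb : 0 < b)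
    {r ρ : IntegralRep 1} (hr : Pinned⟦c, a, (b + 1), r⟧)
    (hρ : Pinned⟦(c * ((b / (a + b) : ℚ) : ℝ)), a, b, ρ⟧) : Equivalent r ρ := by
  obtain ⟨T₁, hT₁⟩ := exists_pinned (((a + b : ℚ)) : ℝ) (isAlgebraic_rat ℚ (a + b)) ha
    (by linarith : 0 < b + 1)
  obtain ⟨T₂, hT₂⟩ := exists_pinned ((b : ℚ) : ℝ) (isAlgebraic_rat ℚ b) ha hb
  have h12 : Equivalent T₁ T₂ := by
    refine betaTranslation_equivalent a b ha hb T₁ T₂ hT₁.1 (fun x hx => ?_) hT₂.1 (fun x hx => ?_)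
    · simp only [hT₁.2 hx, Rat.cast_add, Rat.cast_one, add_sub_cancel_right]
      ring
    · simp only [hT₂.2 hx]
      ring
  set k : ℝ := c * (((1 / (a + b) : ℚ)) : ℝ) with hk_def
  have hk : IsAlgebraic ℚ k := hc.mul (isAlgebraic_rat ℚ _)
  have e₁ : Equivalent r (T₁.constMul k hk) := by
    refine equivalent_constMul_of_pinned hk hr hT₁ ?_
    rw [hk_def]
    push_cast
    field_simp
  have e₂ : Equivalent ρ (T₂.constMul k hk) := by
    refine equivalent_constMul_of_pinned hk hρ hT₂ ?_
    rw [hk_def]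
    push_cast
    ring
  exact e₁.trans ((h12.constMul k hk).trans e₂.symm)

/-- `P⟦a, b, a', b'⟧` is symmetric in the two pairs. [folklore] -/
theorem P_symm {a b a' b' : ℚ} (h : P⟦a, b, a', b'⟧) : P⟦a', b', a, b⟧ :=
  fun c c' r r' hc hc' hr hr' hv => (h c' c r' r hc' hc hr' hr hv.symm).symm

/-- Swapping the exponents on the left (reflection move + soundness). [cite: KontsevichZagier2001, §1.2 rule (2)] -/
theorem P_swap_left {a b a' b' : ℚ} (ha : 0 < a) (hb : 0 < b) (h : P⟦b, a, a', b'⟧) : P⟦a, b, a', b'⟧ := by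
  intro c c' r r' hc hc' hr hr' hv
  obtain ⟨ρ, hρ⟩ := exists_pinned c hc hb ha
  have e : Equivalent r ρ := pinned_swap hc ha hb hr hρ
  have hv' : ρ.value = r'.value := (Equivalent.value_eq_holds e).symm.trans hv
  exact e.trans (h c c' ρ r' hc hc' hρ hr' hv')

/-- Lowering the second exponent on the left by one (translation move + soundness). [cite: AndrewsAskeyRoy1999, §1.1] -/
theorem P_lower_left {a b a' b' : ℚ} (ha : 0 < a) (hb : 0 < b) (h : P⟦a, b, a', b'⟧) :
    P⟦a, (b + 1), a', b'⟧ := by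
  intro c c' r r' hc hc' hr hr' hv
  have hk : IsAlgebraic ℚ (c * ((b / (a + b) : ℚ) : ℝ)) := hc.mul (isAlgebraic_rat ℚ _)
  obtain ⟨ρ, hρ⟩ := exists_pinned _ hk ha hb
  have e : Equivalent r ρ := pinned_translate hc ha hb hr hρ
  have hv' : ρ.value = r'.value := (Equivalent.value_eq_holds e).symm.trans hv
  exact e.trans (h _ c' ρ r' hk hc' hρ hr' hv')

/-- LEVEL REDUCTION on the left pair, KEEPING HALF-INTEGRALITY: if `P⟦a₀, b₀, a', b'⟧` holds for all half-integer exponents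
`a₀, b₀ ∈ (0,1]`, it holds for all positive half-integers `a, b` (strong induction on `⌊a⌋ + ⌊b⌋`, translating and swapping;
`b − 1` is a half-integer when `b` is). [folklore] -/
theorem P_of_base_left_half {a' b' : ℚ}
    (base : ∀ a b : ℚ, 0 < a → a ≤ 1 → 0 < b → b ≤ 1 → (∃ m : ℤ, a = m / 2) → (∃ m : ℤ, b = m / 2) → P⟦a, b, a', b'⟧) :
    ∀ a b : ℚ, 0 < a → 0 < b → (∃ m : ℤ, a = m / 2) → (∃ m : ℤ, b = m / 2) → P⟦a, b, a', b'⟧ := by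
  have hsub : ∀ {q : ℚ}, (∃ m : ℤ, q = m / 2) → ∃ m : ℤ, q - 1 = m / 2 := by
    rintro q ⟨m, rfl⟩
    exact ⟨m - 2, by push_cast; ring⟩
  suffices H : ∀ n : ℕ, ∀ a b : ℚ, ⌊a⌋₊ + ⌊b⌋₊ = n → 0 < a → 0 < b → (∃ m : ℤ, a = m / 2) → (∃ m : ℤ, b = m / 2) →
      P⟦a, b, a', b'⟧ from
    fun a b ha hb hma hmb => H _ a b rfl ha hb hma hmb
  intro n
  induction n using Nat.strong_induction_on with
  | _ n ih =>
    intro a b hn ha hb hma hmb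
    by_cases hb1 : b ≤ 1
    · by_cases ha1 : a ≤ 1
      · exact base a b ha ha1 hb hb1 hma hmb
      · push Not at ha1
        have ha' : 0 < a - 1 := by linarith
        have hfl : ⌊a⌋₊ = ⌊a - 1⌋₊ + 1 := by
          conv_lhs => rw [← sub_add_cancel a 1]
          exact Nat.floor_add_one ha'.le
        have hlt : ⌊b⌋₊ + ⌊a - 1⌋₊ < n := by omega
        have hP : P⟦b, (a - 1), a', b'⟧ := ih _ hlt b (a - 1) rfl hb ha' hmb (hsub hma)
        have hP' : P⟦b, a, a', b'⟧ := by simpa using P_lower_left hb ha' hP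
        exact P_swap_left ha hb hP'
    · push Not at hb1
      have hb' : 0 < b - 1 := by linarith
      have hfl : ⌊b⌋₊ = ⌊b - 1⌋₊ + 1 := by
        conv_lhs => rw [← sub_add_cancel b 1]
        exact Nat.floor_add_one hb'.le
      have hlt : ⌊a⌋₊ + ⌊b - 1⌋₊ < n := by omega
      have hP : P⟦a, (b - 1), a', b'⟧ := ih _ hlt a (b - 1) rfl ha hb' hma (hsub hmb)
      simpa using P_lower_left ha hb' hP

/-! ## Level 2: the two classes -/

/-- A positive half-integer in `(0,1]` is `1/2` or `1`. [folklore] -/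
theorem half_cases {a : ℚ} (ha : 0 < a) (ha1 : a ≤ 1) (hm : ∃ m : ℤ, a = m / 2) : a = 1 / 2 ∨ a = 1 := by
  obtain ⟨m, rfl⟩ := hm
  have h1 : (0 : ℚ) < m := by linarith
  have h2 : (m : ℚ) ≤ 2 := by linarith
  have h1' : 0 < m := by exact_mod_cast h1
  have h2' : m ≤ 2 := by exact_mod_cast h2
  interval_cases m <;> norm_num

/-- THE `π`-CLASS: the value of `[c·t^{-1/2}(1-t)^{-1/2}]` is `c·π` (`Γ(1/2)² / Γ(1) = π`). [cite: AndrewsAskeyRoy1999, Thm 1.1.4] -/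
theorem value_half_half {c : ℝ} {r : IntegralRep 1} (hr : Pinned⟦c, (1/2 : ℚ), (1/2 : ℚ), r⟧) : r.value = c * Real.pi := by
  rw [value_of_pinned hr (by norm_num) (by norm_num)]
  have h : Real.Gamma (((1/2 : ℚ)) : ℝ) = Real.sqrt Real.pi := by
    rw [show (((1/2 : ℚ)) : ℝ) = 1 / 2 by norm_num, Real.Gamma_one_half_eq]
  rw [h, show (((1/2 : ℚ)) : ℝ) + (((1/2 : ℚ)) : ℝ) = 1 by norm_num, Real.Gamma_one, div_one,
    Real.mul_self_sqrt Real.pi_pos.le]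

/-- THE RATIONAL CLASS, first cell: `[c·t^{-1/2}] ∼ [pt, 2c]` (`β(1/2, 1) ∼ [pt, 2]` by ONE Newton–Leibniz move with primitive
`2t^{1/2}`, `KZ.betaFirst_equivalent_unit_constMul`, transported through `c`). [cite: KontsevichZagier2001, §1.2 rule (3)] -/
theorem equivalent_point_half_one {c : ℝ} (hc : IsAlgebraic ℚ c) {r : IntegralRep 1}
    (hr : Pinned⟦c, (1/2 : ℚ), (1 : ℚ), r⟧) :
    Equivalent r (IntegralRep.unit.constMul (c * 2) (hc.mul (isAlgebraic_nat 2))) := by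
  obtain ⟨T, hT⟩ := exists_pinned 1 isAlgebraic_one (by norm_num : (0:ℚ) < 1/2) (by norm_num : (0:ℚ) < 1)
  have hinv : IsAlgebraic ℚ ((((1/2 : ℚ)) : ℝ)⁻¹) := (isAlgebraic_rat ℚ (1/2 : ℚ)).inv
  have hβ : Equivalent T (IntegralRep.unit.constMul ((((1/2 : ℚ)) : ℝ)⁻¹) hinv) :=
    betaFirst_equivalent_unit_constMul (1/2) (by norm_num) T hT.1 (fun x hx => by simp only [hT.2 hx, one_mul]) hinv
  have e₁ : Equivalent r (T.constMul c hc) := equivalent_constMul_of_pinned hc hr hT (mul_one c).symm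
  refine e₁.trans ((hβ.constMul c hc).trans ?_)
  refine of_sub_of_mem_relations_of_eqOn rfl fun x _ => ?_
  simp only [IntegralRep.integrand_constMul, IntegralRep.unit_integrand]
  norm_num

/-- THE RATIONAL CLASS, second cell: `[c·(1-t)^{-1/2}] ∼ [pt, 2c]` (swap, then the first cell). [cite: KontsevichZagier2001, §1.2 rules (2),(3)] -/
theorem equivalent_point_one_half {c : ℝ} (hc : IsAlgebraic ℚ c) {r : IntegralRep 1}
    (hr : Pinned⟦c, (1 : ℚ), (1/2 : ℚ), r⟧) :
    Equivalent r (IntegralRep.unit.constMul (c * 2) (hc.mul (isAlgebraic_nat 2))) := by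
  obtain ⟨ρ, hρ⟩ := exists_pinned c hc (by norm_num : (0:ℚ) < 1/2) (by norm_num : (0:ℚ) < 1)
  exact (pinned_swap hc (by norm_num) (by norm_num) hr hρ).trans (equivalent_point_half_one hc hρ)

/-- THE RATIONAL CLASS, third cell: `[c] ∼ [pt, c]` (`β(1,1) ∼ [pt, 1]`). [cite: KontsevichZagier2001, §1.2 rule (3)] -/
theorem equivalent_point_one_one {c : ℝ} (hc : IsAlgebraic ℚ c) {r : IntegralRep 1}
    (hr : Pinned⟦c, (1 : ℚ), (1 : ℚ), r⟧) :
    Equivalent r (IntegralRep.unit.constMul (c * 1) (hc.mul isAlgebraic_one)) := by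
  obtain ⟨T, hT⟩ := exists_pinned 1 isAlgebraic_one (by norm_num : (0:ℚ) < 1) (by norm_num : (0:ℚ) < 1)
  have hinv : IsAlgebraic ℚ ((((1 : ℚ)) : ℝ)⁻¹) := (isAlgebraic_rat ℚ (1 : ℚ)).inv
  have hβ : Equivalent T (IntegralRep.unit.constMul ((((1 : ℚ)) : ℝ)⁻¹) hinv) :=
    betaFirst_equivalent_unit_constMul 1 (by norm_num) T hT.1 (fun x hx => by simp only [hT.2 hx, one_mul]) hinv
  have e₁ : Equivalent r (T.constMul c hc) := equivalent_constMul_of_pinned hc hr hT (mul_one c).symm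
  refine e₁.trans ((hβ.constMul c hc).trans ?_)
  refine of_sub_of_mem_relations_of_eqOn rfl fun x _ => ?_
  simp only [IntegralRep.integrand_constMul, IntegralRep.unit_integrand]
  norm_num

/-- THE RATIONAL CLASS, uniformly: a cell pinned with `(a, b) ∈ {(1/2,1), (1,1/2), (1,1)}` is equivalent to the point
representation `[pt, c·q]` for a positive rational `q` (namely `2, 2, 1`), hence has value `c·q`. [cite: KontsevichZagier2001, §1.2] -/
theorem exists_point_of_rational_class {c : ℝ} (hc : IsAlgebraic ℚ c) {a b : ℚ} {r : IntegralRep 1}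
    (hab : (a = 1/2 ∧ b = 1) ∨ (a = 1 ∧ b = 1/2) ∨ (a = 1 ∧ b = 1)) (hr : Pinned⟦c, a, b, r⟧) :
    ∃ (q : ℚ) (hk : IsAlgebraic ℚ (c * q)), 0 < q ∧ Equivalent r (IntegralRep.unit.constMul (c * q) hk) ∧
      r.value = c * q := by
  have hval : ∀ {q : ℚ} (hk : IsAlgebraic ℚ (c * q)), Equivalent r (IntegralRep.unit.constMul (c * q) hk) →
      r.value = c * q := fun hk e => by
    rw [Equivalent.value_eq_holds e, IntegralRep.value_constMul, IntegralRep.value_unit, mul_one]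
  rcases hab with ⟨rfl, rfl⟩ | ⟨rfl, rfl⟩ | ⟨rfl, rfl⟩
  · refine ⟨2, by simpa using hc.mul (isAlgebraic_nat 2), by norm_num, ?_, ?_⟩
    · simpa using equivalent_point_half_one hc hr
    · simpa using hval (q := 2) (by simpa using hc.mul (isAlgebraic_nat 2)) (by simpa using equivalent_point_half_one hc hr)
  · refine ⟨2, by simpa using hc.mul (isAlgebraic_nat 2), by norm_num, ?_, ?_⟩
    · simpa using equivalent_point_one_half hc hr
    · simpa using hval (q := 2) (by simpa using hc.mul (isAlgebraic_nat 2)) (by simpa using equivalent_point_one_half hc hr)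
  · refine ⟨1, by simpa using hc, by norm_num, ?_, ?_⟩
    · simpa using equivalent_point_one_one hc hr
    · simpa using hval (q := 1) (by simpa using hc) (by simpa using equivalent_point_one_one hc hr)

/-- Classification at level `2`: exponents in `{1/2, 1}` give the `π`-class `(1/2, 1/2)` or the rational class. [folklore] -/
theorem class_cases {a b : ℚ} (ha : a = 1/2 ∨ a = 1) (hb : b = 1/2 ∨ b = 1) :
    (a = 1/2 ∧ b = 1/2) ∨ ((a = 1/2 ∧ b = 1) ∨ (a = 1 ∧ b = 1/2) ∨ (a = 1 ∧ b = 1)) := by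
  rcases ha with rfl | rfl <;> rcases hb with rfl | rfl <;> simp

/-- **The base of the half-integer sector**: `P⟦a, b, a', b'⟧` for all exponents in `{1/2, 1}` — equal constants in the `π`-class,
a common point representation in the rational class, and NO coincidence between the classes for non-zero algebraic constants by
Lindemann (`π ∉ ℚ̄`, `transcendental_pi_holds`); the degenerate constants `c = 0` give two zero representations.
[cite: KontsevichZagier2001, §1.2] -/
theorem P_base_half {a b a' b' : ℚ} (ha : a = 1/2 ∨ a = 1) (hb : b = 1/2 ∨ b = 1) (ha' : a' = 1/2 ∨ a' = 1)
    (hb' : b' = 1/2 ∨ b' = 1) : P⟦a, b, a', b'⟧ := by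
  have hpos : ∀ {q : ℚ}, (q = 1/2 ∨ q = 1) → 0 < q := by rintro q (rfl | rfl) <;> norm_num
  intro c c' r r' hc hc' hr hr' hv
  have hvr := value_of_pinned hr (hpos ha) (hpos hb)
  have hvr' := value_of_pinned hr' (hpos ha') (hpos hb')
  have hBpos : ∀ {p q : ℚ}, 0 < p → 0 < q →
      0 < Real.Gamma (p:ℝ) * Real.Gamma (q:ℝ) / Real.Gamma ((p:ℝ) + (q:ℝ)) := fun {p q} hp hq => by
    have hpR : (0:ℝ) < p := by exact_mod_cast hp
    have hqR : (0:ℝ) < q := by exact_mod_cast hq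
    exact div_pos (mul_pos (Real.Gamma_pos_of_pos hpR) (Real.Gamma_pos_of_pos hqR)) (Real.Gamma_pos_of_pos (by linarith))
  -- the degenerate constants
  by_cases hc0 : c = 0
  · have hc'0 : c' = 0 := by
      have h0 : c' * (Real.Gamma (a':ℝ) * Real.Gamma (b':ℝ) / Real.Gamma ((a':ℝ) + (b':ℝ))) = 0 := by
        rw [← hvr', ← hv, hvr, hc0, zero_mul]
      exact (mul_eq_zero.1 h0).resolve_right (hBpos (hpos ha') (hpos hb')).ne'
    have h1 : of r ∈ relations := of_mem_relations_of_eqOn_zero r fun x hx => by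
      rw [hr.2 hx]
      simp [hc0]
    have h2 : of r' ∈ relations := of_mem_relations_of_eqOn_zero r' fun x hx => by
      rw [hr'.2 hx]
      simp [hc'0]
    exact relations.sub_mem h1 h2
  have hc'0 : c' ≠ 0 := by
    intro h
    have h0 : c * (Real.Gamma (a:ℝ) * Real.Gamma (b:ℝ) / Real.Gamma ((a:ℝ) + (b:ℝ))) = 0 := by
      rw [← hvr, hv, hvr', h, zero_mul]
    exact hc0 ((mul_eq_zero.1 h0).resolve_right (hBpos (hpos ha) (hpos hb)).ne')
  have hπ : ¬ IsAlgebraic ℚ Real.pi := transcendental_pi_holds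
  rcases class_cases ha hb with ⟨rfl, rfl⟩ | hrat <;> rcases class_cases ha' hb' with ⟨rfl, rfl⟩ | hrat'
  · -- π-class on both sides: equal constants
    have hcc : c = c' := by
      have h := hv
      rw [value_half_half hr, value_half_half hr'] at h
      exact mul_right_cancel₀ Real.pi_pos.ne' h
    subst hcc
    exact of_sub_of_mem_relations_of_eqOn (by rw [hr.1, hr'.1]) fun x hx => by
      have hx' : x ∈ r'.domain := by rw [hr'.1, ← hr.1]; exact hx
      rw [hr.2 hx, hr'.2 hx']
  · -- π-class versus rational class: Lindemann
    exfalso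
    obtain ⟨q, hk, hq, -, hval'⟩ := exists_point_of_rational_class hc' hrat' hr'
    have h := hv
    rw [value_half_half hr, hval'] at h
    -- `π = c' q / c` is algebraic
    have hpi : Real.pi = c' * q / c := by field_simp; linarith
    exact hπ (hpi ▸ (hk.mul hc.inv))
  · -- rational class versus π-class: Lindemann
    exfalso
    obtain ⟨q, hk, hq, -, hval⟩ := exists_point_of_rational_class hc hrat hr
    have h := hv
    rw [value_half_half hr', hval] at h
    have hpi : Real.pi = c * q / c' := by field_simp; linarith
    exact hπ (hpi ▸ (hk.mul hc'.inv))
  · -- rational class on both sides: a common point representation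
    obtain ⟨q, hk, hq, e, hval⟩ := exists_point_of_rational_class hc hrat hr
    obtain ⟨q', hk', hq', e', hval'⟩ := exists_point_of_rational_class hc' hrat' hr'
    have hqq : c * q = c' * q' := by rw [← hval, ← hval', hv]
    have emid : Equivalent (IntegralRep.unit.constMul (c * q) hk) (IntegralRep.unit.constMul (c' * q') hk') :=
      of_sub_of_mem_relations_of_eqOn rfl fun x _ => by
        simp only [IntegralRep.integrand_constMul, hqq]
    exact e.trans (emid.trans e'.symm)

/-- **`P⟦a, b, a', b'⟧` on the whole half-integer sector**: reduce the right pair, then the left pair, to level `2`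
(`P_of_base_left_half`, keeping half-integrality) and apply `P_base_half`. [folklore] -/
theorem P_all_half {a b a' b' : ℚ} (ha : 0 < a) (hb : 0 < b) (ha' : 0 < a') (hb' : 0 < b')
    (hma : ∃ m : ℤ, a = m / 2) (hmb : ∃ m : ℤ, b = m / 2) (hma' : ∃ m : ℤ, a' = m / 2) (hmb' : ∃ m : ℤ, b' = m / 2) :
    P⟦a, b, a', b'⟧ := by
  refine P_of_base_left_half (fun a₀ b₀ ha₀ ha₀1 hb₀ hb₀1 hma₀ hmb₀ => ?_) a b ha hb hma hmb
  refine P_symm (P_of_base_left_half (a' := a₀) (b' := b₀)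
    (fun a₁ b₁ ha₁ ha₁1 hb₁ hb₁1 hma₁ hmb₁ => ?_) a' b' ha' hb' hma' hmb')
  exact P_base_half (half_cases ha₁ ha₁1 hma₁) (half_cases hb₁ hb₁1 hmb₁) (half_cases ha₀ ha₀1 hma₀)
    (half_cases hb₀ hb₀1 hmb₀)

/-- **`BetaLinearSector` ON THE HALF-INTEGER SECTOR, UNCONDITIONALLY**: Conjecture 1 of Kontsevich–Zagier for every pair of Beta
integrals `[∫₀¹ t^{a-1}(1-t)^{b-1}dt]`, `[∫₀¹ c·t^{a'-1}(1-t)^{b'-1}dt]` with `a, b, a', b' ∈ ½ℕ_{>0}`, `c` real algebraic, and equal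
values — the registered anchor `betaLinearSector_halfIntegers` of crux stmt-3897 (its statement restricted by the four half-integrality
hypotheses).  Inputs: the Beta integral, the proved translation/reflection chains, `β(a,1) ∼ [pt, 1/a]`, and Lindemann's theorem
`transcendental_pi_holds`. [cite: KontsevichZagier2001, §1.2] -/
theorem betaLinearSector_halfIntegers : ∀ (a b a' b' : ℚ) (c : ℝ), 0 < a → 0 < b → 0 < a' → 0 < b' → IsAlgebraic ℚ c →
    (∃ m : ℤ, a = m / 2) → (∃ m : ℤ, b = m / 2) → (∃ m : ℤ, a' = m / 2) → (∃ m : ℤ, b' = m / 2) →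
    ∀ (r r' : KZ.IntegralRep 1), r.domain = {x | x 0 ∈ Set.Ioo (0:ℝ) 1} →
    Set.EqOn r.integrand (fun x => (x 0) ^ ((a:ℝ) - 1) * (1 - x 0) ^ ((b:ℝ) - 1)) r.domain →
    r'.domain = {x | x 0 ∈ Set.Ioo (0:ℝ) 1} →
    Set.EqOn r'.integrand (fun x => c * (x 0) ^ ((a':ℝ) - 1) * (1 - x 0) ^ ((b':ℝ) - 1)) r'.domain →
    r.value = r'.value → KZ.Equivalent r r' := by
  intro a b a' b' c ha hb ha' hb' hc hma hmb hma' hmb' r r' hd hi hd' hi' hv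
  refine P_all_half ha hb ha' hb' hma hmb hma' hmb' 1 c r r' isAlgebraic_one hc ⟨hd, fun x hx => ?_⟩ ⟨hd', hi'⟩ hv
  simp only [hi hx, one_mul]

end Summit.KontsevichZagierPeriods.FermatIsogeny.BetaLinearSector.HalfIntegers

end
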